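import Literature.NumberTheory.Automorphic.LieGraphSwap
import HarnessLib

/-!
# The Lie-algebra isomorphism theorem, IV: the commutant, the projector onto `Lie(T₁)` and the
trace functionals killing the graph subalgebra (trunk T-AUTOMORPHIC, G25 AutomorphicL; DAG of `chevalley_isomorphism`)

Continuation of `LieGraphSetup/Core/Swap.lean`. Humphreys' proof of the isomorphism theorem (14.2)
is for *simple* Lie algebras, where the ideal `{w | (0, w) ∈ D}` of `𝔤₂` is `0` or `𝔤₂`; for the
*reductive* `𝔤ⱼ = Lie(Gⱼ)` at hand a central element of `𝔤₂` could a priori hide in `D`. This file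
provides the tool that excludes it (used in part V): a family of linear functionals on
`𝕃 = 𝔤𝔩_{n₁} × 𝔤𝔩_{n₂}` vanishing on `D` and detecting central elements of `𝔤₂` through the traces
of their powers (the `k`-points substitute for "`𝔤 = 𝔷 ⊕ [𝔤, 𝔤]`").

* The commutant: `commute_of_mem_lieAlgebraGL_of_forall` (a matrix commuting with `G` commutes
  with `Lie(G)`: differentiate the linear equations `g φ = φ g`), `trace_commutator_mul_eq_zero`
  (`tr ([B, B'] φ) = 0` when `φ` commutes with `B'`), and **`forall_mul_eq_mul_of_central`**
  (an element of `Lie(T₂)` commuting with all root vectors `e²_γ` commutes with `G₂`, which is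
  generated by `T₂` and the root subgroups `exp(k e²_γ)`, `torus_sup_rootSubgroups_eq_of_lieWeights_subset`).
* The projector `piOp h₁ l = ∏_{γ ∈ l} (1 - ½ ad h¹_γ)` of `𝔤𝔩_{n₁}`: scalar `∏ (1 - ½⟨x, α_γ^∨⟩)` on
  `𝔤₁_x` (`piOp_apply_of_mem`), the identity on `Lie(T₁)`, zero on `𝔤₁_{α_γ}` for `γ ∈ l`, and
  `piOp l (𝔤₁) ⊆ Lie(T₁)` when `l` lists all roots (`piOp_mem_lieAlgebraGL_torus`).
* The functional **`traceFunctional φ`**: `Ψ_φ (A, B) = tr (B φ) - tr (θ♯ (π A) φ)` with `θ♯` a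
  linear extension of `θ : Lie(T₁) ≅ Lie(T₂)` (`thetaExt`), for `φ` commuting with `G₂`;
  **`traceFunctional_lie_eq_zero`** (`Ψ_φ` kills `[𝔤₁ × 𝔤₂, 𝔤₁ × 𝔤₂]`: on `𝔤₂` by the commutant,
  on `𝔤₁` by checking pairs of weight components — `[𝔤_γ, 𝔤_{-γ}] = k h¹_γ`, `θ h¹_γ = h²_γ = [e²_γ, f²_γ]`),
  `traceFunctional_eq_zero_of_mem_genSet`, whence **`traceFunctional_eq_zero_of_mem`**:
  `Ψ_φ` vanishes on `D`; in particular `tr (B φ) = 0` whenever `(0, B) ∈ D`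
  (`trace_mul_eq_zero_of_inr_mem`).

## References

* [Humphreys1972] J. E. Humphreys, *Introduction to Lie Algebras and Representation Theory*,
  GTM 9, Springer (1972), §14.2, §19.1.
* [SpringerLAG1998] T. A. Springer, *Linear Algebraic Groups*, 2nd ed. (1998), 4.4.5, 7.1.1, 8.1.1.
-/

noncomputable section

open scoped MatrixGroups IsMulCommutative
open Set

attribute [local instance 100] LieRing.ofAssociativeRing

namespace Literature.NumberTheory.Automorphic

/-! ### The commutant of `G` and `Lie(G)` -/

section Commutant

variable {k : Type*} [Field k] {n : Type*} [Fintype n] [DecidableEq n] {G : Subgroup (GL n k)}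

/-- **A matrix commuting with `G` commutes with `Lie(G)`**: the linear polynomials
`(x φ - φ x)_{ij}` vanish on `G`, hence their differentials `(X φ - φ X)_{ij}` vanish on `Lie(G)`.
[cite: SpringerLAG1998, 4.4.5] -/
theorem commute_of_mem_lieAlgebraGL_of_forall {φ : Matrix n n k}
    (hφ : ∀ g ∈ G, ((g : GL n k) : Matrix n n k) * φ = φ * g) {X : Matrix n n k}
    (hX : X ∈ lieAlgebraGL G) : X * φ = φ * X := by
  ext i j
  -- the linear polynomial `∑_l φ_{lj} x_{il} - φ_{il} x_{lj}`, vanishing on `G`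
  set q : MvPolynomial (GLCoord n) k :=
    ∑ l, (MvPolynomial.C (φ l j) * MvPolynomial.X (Sum.inl (i, l)) -
      MvPolynomial.C (φ i l) * MvPolynomial.X (Sum.inl (l, j))) with hq
  have hqG : q ∈ MvPolynomial.vanishingIdeal k (glCoordFun '' (G : Set (GL n k))) := by
    rw [MvPolynomial.mem_vanishingIdeal_iff]
    rintro _ ⟨g, hg, rfl⟩
    have h := congrFun (congrFun (hφ g hg) i) j
    rw [Matrix.mul_apply, Matrix.mul_apply] at h
    change MvPolynomial.eval (glCoordFun g) q = 0
    simp only [hq, map_sum, map_sub, map_mul, MvPolynomial.eval_X, MvPolynomial.eval_C, glCoordFun_inl,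
      Finset.sum_sub_distrib]
    rw [sub_eq_zero]
    calc ∑ l, φ l j * (g : Matrix n n k) i l = ∑ l, (g : Matrix n n k) i l * φ l j :=
          Finset.sum_congr rfl fun l _ => mul_comm _ _
      _ = ∑ l, φ i l * (g : Matrix n n k) l j := h
  have h0 := (mem_lieAlgebraGL_iff.1 hX) q hqG
  have hd : tangentDeriv q X = (X * φ - φ * X) i j := by
    rw [hq, tangentDeriv_sum]
    simp only [tangentDeriv_sub, tangentDeriv_C_mul, tangentDeriv_X, tangentCoord, Sum.elim_inl,
      Finset.sum_sub_distrib, Matrix.sub_apply, Matrix.mul_apply]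
    congr 1
    exact Finset.sum_congr rfl fun l _ => mul_comm _ _
  rw [hd, Matrix.sub_apply, sub_eq_zero] at h0
  exact h0

omit [DecidableEq n] in
/-- `tr ([B, B'] φ) = 0` when `φ` commutes with `B'`. [folklore] -/
theorem trace_commutator_mul_eq_zero {B B' φ : Matrix n n k} (h : B' * φ = φ * B') :
    Matrix.trace ((B * B' - B' * B) * φ) = 0 := by
  rw [Matrix.sub_mul, Matrix.trace_sub, Matrix.mul_assoc, Matrix.mul_assoc, h, ← Matrix.mul_assoc,
    Matrix.trace_mul_comm (B * φ) B', ← Matrix.mul_assoc, sub_self]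

/-- A matrix commuting with a nilpotent `A` commutes with `exp A`. [folklore] -/
theorem commute_exp_of_commute [CharZero k] {B A : Matrix n n k} (h : Commute B A) :
    Commute B (IsNilpotent.exp A) := by
  unfold IsNilpotent.exp
  exact Commute.sum_right _ _ _ fun i _ => (h.pow_right i).smul_right _

end Commutant

/-! ### Central elements of `Lie(T₂)` commute with `G₂` -/

section Central

variable {k : Type*} [Field k] [IsAlgClosed k] [CharZero k] {n : Type*} [Fintype n] [DecidableEq n]
variable {ι X Y : Type*} [AddCommGroup X] [AddCommGroup Y]
variable {G T : Subgroup (GL n k)} [IsMulCommutative ↥T]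
variable {P : RootPairing ι ℤ X Y} {eX : Additive ↥(characterLattice T) ≃+ X}
  {eY : Additive ↥(cocharacterLattice T) ≃+ Y}

/-- The subgroup of `GL n k` commuting with a matrix `B`. [folklore] -/
def commutantSubgroup (B : Matrix n n k) : Subgroup (GL n k) where
  carrier := {g | (g : Matrix n n k) * B = B * g}
  one_mem' := by
    change ((1 : GL n k) : Matrix n n k) * B = B * ((1 : GL n k) : Matrix n n k)
    rw [Units.val_one, Matrix.one_mul, Matrix.mul_one]
  mul_mem' := fun {a b} ha hb => by
    change ((a * b : GL n k) : Matrix n n k) * B = B * ((a * b : GL n k) : Matrix n n k)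
    change (a : Matrix n n k) * B = B * a at ha
    change (b : Matrix n n k) * B = B * b at hb
    rw [Units.val_mul, Matrix.mul_assoc, hb, ← Matrix.mul_assoc, ha, Matrix.mul_assoc]
  inv_mem' := fun {a} ha => by
    change (a : Matrix n n k) * B = B * a at ha
    change ((a⁻¹ : GL n k) : Matrix n n k) * B = B * ((a⁻¹ : GL n k) : Matrix n n k)
    have h : ((a⁻¹ : GL n k) : Matrix n n k) * ((a : Matrix n n k) * B) * ((a⁻¹ : GL n k) : Matrix n n k) =
        ((a⁻¹ : GL n k) : Matrix n n k) * (B * a) * ((a⁻¹ : GL n k) : Matrix n n k) := by rw [ha]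
    rw [← Matrix.mul_assoc, ← Matrix.mul_assoc, ← Units.val_mul, inv_mul_cancel, Units.val_one,
      Matrix.one_mul, Matrix.mul_assoc, Matrix.mul_assoc, ← Units.val_mul, mul_inv_cancel,
      Units.val_one, Matrix.mul_one] at h
    exact h.symm

omit [IsAlgClosed k] [CharZero k] [IsMulCommutative ↥T] in
/-- Membership in `commutantSubgroup`. [folklore] -/
lemma mem_commutantSubgroup_iff {B : Matrix n n k} {g : GL n k} :
    g ∈ commutantSubgroup B ↔ (g : Matrix n n k) * B = B * g := Iff.rfl

/-- **An element `B ∈ Lie(T)` commuting with every root vector `e_γ` commutes with `G`**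
(`G` connected reductive, characteristic `0`): `G` is generated by `T`, which commutes with
`Lie(T)`, and the root subgroups, whose elements are `exp (x A)` with `A ∈ 𝔤_γ = k e_γ`.
[cite: SpringerLAG1998, 8.1.1 and 7.1.3] -/
theorem forall_mul_eq_mul_of_central (hG : IsConnectedReductive G) (hT : IsMaximalTorusIn T G)
    (h : IsRootDatumOf G T P eX eY) {B : Matrix n n k} (hB : B ∈ lieAlgebraGL T)
    (hBe : ∀ γ : ι, B * h.rootE γ = h.rootE γ * B) :
    ∀ g ∈ G, ((g : GL n k) : Matrix n n k) * B = B * g := by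
  haveI : Infinite k := IsAlgClosed.instInfinite
  have hTt : IsTorusSubgroup T := hT.2.1
  have h0 := lieWeightSpace_one_le_lieAlgebraGL_holds G T hG hT
  -- `G = T ⊔ ⨆ U_α`
  have hgen := torus_sup_rootSubgroups_eq_of_lieWeights_subset hG.1 hTt hT.1
    (by rw [lieWeights_eq_roots_of_charZero hG.1.1 hTt.1 hT.1])
    (fun α hα => by
      obtain ⟨i, hi⟩ : ∃ i, charOfWeight eX (P.root i) = (α : ↥T →* kˣ) := by
        have : eX (Additive.ofMul α) ∈ Set.range P.root := by rw [h.range_root]; exact ⟨α, hα, rfl⟩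
        obtain ⟨i, hi⟩ := this
        exact ⟨i, by simp [charOfWeight, hi]⟩
      rw [← hi]
      exact finrank_lieWeightSpace_le_one_of_lieWeightSpace_one_le hG hT h0 h i)
    h0
  -- it suffices that the generators commute with `B`
  suffices hle : T ⊔ ⨆ α ∈ roots G T, rootSubgroup G T (α : ↥T →* kˣ) ≤ commutantSubgroup B by
    intro g hg
    rw [← hgen] at hg
    exact hle hg
  refine sup_le (fun t ht => ?_) (iSup₂_le fun α hα => ?_)
  · -- `t B t⁻¹ = B`
    rw [mem_commutantSubgroup_iff]
    have h1 := lieAlgebraGL_le_weightSpaceGL_one hB ⟨t, ht⟩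
    rw [MonoidHom.one_apply, Units.val_one, one_smul] at h1
    have h2 := congrArg (fun M => M * ((t : GL n k) : Matrix n n k)) h1
    simp only at h2
    rw [Matrix.mul_assoc, Matrix.nonsing_inv_mul _ (Matrix.isUnits_det_units _), Matrix.mul_one] at h2
    exact h2
  · -- root subgroups: `u(x) = exp (x A)`, `A = c e_γ`
    refine iSup_le fun hTG => iSup_le fun u => iSup_le fun hu => ?_
    rintro _ ⟨v, ⟨x, rfl⟩, rfl⟩
    rw [mem_commutantSubgroup_iff, Subgroup.coe_subtype]
    obtain ⟨i, hi⟩ : ∃ i, charOfWeight eX (P.root i) = (α : ↥T →* kˣ) := by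
      have : eX (Additive.ofMul α) ∈ Set.range P.root := by rw [h.range_root]; exact ⟨α, hα, rfl⟩
      obtain ⟨i, hi⟩ := this
      exact ⟨i, by simp [charOfWeight, hi]⟩
    have hvel : hu.1.velocity ∈ lieWeightSpace G T (charOfWeight eX (P.root i)) := by
      rw [hi]; exact hu.velocity_mem_lieWeightSpace
    obtain ⟨c, hc⟩ := (h.mem_lieWeightSpace_root_iff hG hT i).1 hvel
    have hnil : IsNilpotent hu.1.velocity :=
      isNilpotent_of_mem_weightSpaceGL hTt.1 α.2 hα.1 hu.velocity_mem_weightSpaceGL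
    have hcomm : Commute B hu.1.velocity := by
      rw [hc]; exact (Commute.smul_right (hBe i) c)
    rw [show x = Multiplicative.ofAdd x.toAdd from rfl, hu.coe_apply_eq_exp hG.1.1 hnil, coe_expHom_apply,
      toAdd_ofAdd]
    exact (commute_exp_of_commute (hcomm.smul_right _)).eq.symm

end Central

namespace LieGraph

variable {k : Type*} [Field k]
variable {n₁ n₂ : Type*} [Fintype n₁] [DecidableEq n₁] [Fintype n₂] [DecidableEq n₂]
variable {ι X Y : Type*} [AddCommGroup X] [AddCommGroup Y]
variable {G₁ T₁ : Subgroup (GL n₁ k)} {G₂ T₂ : Subgroup (GL n₂ k)}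
  [IsMulCommutative ↥T₁] [IsMulCommutative ↥T₂]
variable {P : RootPairing ι ℤ X Y}
variable {eX₁ : Additive ↥(characterLattice T₁) ≃+ X} {eY₁ : Additive ↥(cocharacterLattice T₁) ≃+ Y}
variable {eX₂ : Additive ↥(characterLattice T₂) ≃+ X} {eY₂ : Additive ↥(cocharacterLattice T₂) ≃+ Y}

/-! ### The projector `∏ (1 - ½ ad h¹_γ)` -/

section Projector

variable [IsAlgClosed k] [CharZero k] (h₁ : IsRootDatumOf G₁ T₁ P eX₁ eY₁)

/-- The factor `1 - ½ ad h¹_γ` of the projector, as an endomorphism of `𝔤𝔩_{n₁}`. [folklore] -/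
def piFactor (γ : ι) : Module.End k (Matrix n₁ n₁ k) :=
  1 - (2 : k)⁻¹ • LieModule.toEnd k (Matrix n₁ n₁ k) (Matrix n₁ n₁ k) (h₁.rootH γ)

omit [IsAlgClosed k] [CharZero k] in
/-- Unfolding of `piFactor`. [folklore] -/
lemma piFactor_apply (γ : ι) (A : Matrix n₁ n₁ k) :
    piFactor h₁ γ A = A - (2 : k)⁻¹ • (h₁.rootH γ * A - A * h₁.rootH γ) := by
  simp [piFactor, Ring.lie_def]

/-- **The projector `π_l = ∏_{γ ∈ l} (1 - ½ ad h¹_γ)`** (`l` a list of roots). [folklore] -/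
def piOp (l : List ι) : Module.End k (Matrix n₁ n₁ k) := (l.map (piFactor h₁)).prod

omit [CharZero k] in
/-- **`π_l` is the scalar `∏ (1 - ½ ⟨x, α_γ^∨⟩)` on `𝔤₁_x`.** [cite: Humphreys1972, 8.4] -/
theorem piOp_apply_of_mem (l : List ι) {x : X} {A : Matrix n₁ n₁ k}
    (hA : A ∈ weightSpaceGL T₁ (charOfWeight eX₁ x)) :
    piOp h₁ l A = (l.map fun γ => (1 - (2 : k)⁻¹ * ((P.toLinearMap x (P.coroot γ) : ℤ) : k))).prod • A := by
  haveI : Infinite k := IsAlgClosed.instInfinite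
  induction l with
  | nil => simp [piOp]
  | cons γ l ih =>
    rw [piOp, List.map_cons, List.prod_cons, Module.End.mul_apply, ← piOp, ih, map_smul,
      piFactor_apply, h₁.lie_rootH_of_mem_weightSpaceGL γ x hA, smul_smul, List.map_cons, List.prod_cons]
    have e : A - ((2 : k)⁻¹ * ((P.toLinearMap x (P.coroot γ) : ℤ) : k)) • A =
        (1 - (2 : k)⁻¹ * ((P.toLinearMap x (P.coroot γ) : ℤ) : k)) • A := by rw [sub_smul, one_smul]
    rw [e, smul_smul, mul_comm]

omit [CharZero k] in
/-- `π_l` is the identity on `Lie(T₁)`. [folklore] -/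
theorem piOp_apply_of_mem_torus (l : List ι) {H : Matrix n₁ n₁ k} (hH : H ∈ lieAlgebraGL T₁) :
    piOp h₁ l H = H := by
  have hH' : H ∈ weightSpaceGL T₁ (charOfWeight eX₁ 0) := by
    have : charOfWeight eX₁ (0 : X) = 1 := by simp [charOfWeight]
    rw [this]; exact lieAlgebraGL_le_weightSpaceGL_one hH
  rw [piOp_apply_of_mem h₁ l hH']
  simp

/-- `π_l` kills `𝔤₁_{α_γ}` for `γ ∈ l`. [folklore] -/
theorem piOp_apply_of_mem_root (l : List ι) {γ : ι} (hγ : γ ∈ l) {A : Matrix n₁ n₁ k}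
    (hA : A ∈ weightSpaceGL T₁ (charOfWeight eX₁ (P.root γ))) : piOp h₁ l A = 0 := by
  rw [piOp_apply_of_mem h₁ l hA]
  have h0 : (l.map fun γ' => (1 - (2 : k)⁻¹ * ((P.toLinearMap (P.root γ) (P.coroot γ') : ℤ) : k))).prod = 0 := by
    apply List.prod_eq_zero
    rw [List.mem_map]
    refine ⟨γ, hγ, ?_⟩
    rw [P.root_coroot_eq_pairing, P.pairing_same]
    norm_num
  rw [h0, zero_smul]

omit [CharZero k] in
/-- `π_l` preserves `𝔤₁`. [folklore] -/
theorem piOp_mem_lieAlgebraGL (l : List ι) {A : Matrix n₁ n₁ k} (hA : A ∈ lieAlgebraGL G₁) :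
    piOp h₁ l A ∈ lieAlgebraGL G₁ := by
  haveI : Infinite k := IsAlgClosed.instInfinite
  induction l with
  | nil => simpa [piOp] using hA
  | cons γ l ih =>
    rw [piOp, List.map_cons, List.prod_cons, Module.End.mul_apply, ← piOp, piFactor_apply]
    exact Submodule.sub_mem _ ih (Submodule.smul_mem _ _ (lie_mem_lieAlgebraGL (h₁.rootH_mem_lieAlgebraGL' γ) ih))

include h₁ in
/-- `𝔤₁ ⊆ Lie(T₁) + ∑_γ 𝔤₁_{α_γ}` (Springer 7.1.1 with `P = R`). [cite: SpringerLAG1998, 7.1.1] -/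
theorem lieAlgebraGL_le_torus_sup_roots (hG₁ : IsConnectedReductive G₁) (hT₁ : IsMaximalTorusIn T₁ G₁) :
    lieAlgebraGL G₁ ≤ lieAlgebraGL T₁ ⊔ ⨆ γ : ι, lieWeightSpace G₁ T₁ (charOfWeight eX₁ (P.root γ)) := by
  rw [lieAlgebraGL_eq_sup_iSup_lieWeights T₁ hT₁.1 hT₁.2.1.2.2]
  refine sup_le ?_ (iSup₂_le fun α hα => ?_)
  · rw [lieWeightSpace_one_eq hG₁ hT₁]; exact le_sup_left
  · have hαR : α ∈ roots G₁ T₁ := by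
      rw [← lieWeights_eq_roots_of_charZero hG₁.1.1 hT₁.2.1.1 hT₁.1]; exact hα
    obtain ⟨i, hi⟩ : ∃ i, charOfWeight eX₁ (P.root i) = (α : ↥T₁ →* kˣ) := by
      have : eX₁ (Additive.ofMul α) ∈ Set.range P.root := by rw [h₁.range_root]; exact ⟨α, hαR, rfl⟩
      obtain ⟨i, hi⟩ := this
      exact ⟨i, by simp [charOfWeight, hi]⟩
    rw [← hi]
    exact le_sup_of_le_right (le_iSup (fun γ => lieWeightSpace G₁ T₁ (charOfWeight eX₁ (P.root γ))) i)

/-- **`π_l (𝔤₁) ⊆ Lie(T₁)` when `l` contains every root index.** [folklore] -/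
theorem piOp_mem_lieAlgebraGL_torus (hG₁ : IsConnectedReductive G₁) (hT₁ : IsMaximalTorusIn T₁ G₁)
    {l : List ι} (hl : ∀ γ, γ ∈ l) {A : Matrix n₁ n₁ k} (hA : A ∈ lieAlgebraGL G₁) :
    piOp h₁ l A ∈ lieAlgebraGL T₁ := by
  have hle := lieAlgebraGL_le_torus_sup_roots h₁ hG₁ hT₁ (eX₁ := eX₁)
  suffices hsub : lieAlgebraGL T₁ ⊔ ⨆ γ : ι, lieWeightSpace G₁ T₁ (charOfWeight eX₁ (P.root γ)) ≤
      (lieAlgebraGL T₁).comap (piOp h₁ l) from hsub (hle hA)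
  refine sup_le (fun H hH => ?_) (iSup_le fun γ => fun B hB => ?_)
  · rw [Submodule.mem_comap, piOp_apply_of_mem_torus h₁ l hH]; exact hH
  · rw [Submodule.mem_comap, piOp_apply_of_mem_root h₁ l (hl γ) hB.2]; exact Submodule.zero_mem _

end Projector

/-! ### The trace functionals -/

section Functional

variable [IsAlgClosed k] [CharZero k] [Fintype ι]
variable (hG₁ : IsConnectedReductive G₁) (hT₁ : IsMaximalTorusIn T₁ G₁)
  (hG₂ : IsConnectedReductive G₂) (hT₂ : IsMaximalTorusIn T₂ G₂)
  (h₁ : IsRootDatumOf G₁ T₁ P eX₁ eY₁) (h₂ : IsRootDatumOf G₂ T₂ P eX₂ eY₂)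

/-- A linear extension `θ♯ : 𝔤𝔩_{n₁} → 𝔤𝔩_{n₂}` of `θ : Lie(T₁) ≅ Lie(T₂)`. [folklore] -/
def thetaExt : Matrix n₁ n₁ k →ₗ[k] Matrix n₂ n₂ k :=
  (LinearMap.exists_extend ((lieAlgebraGL T₂).subtype.comp
    (theta eX₁ eX₂ hT₁.2.1 hT₂.2.1).toLinearMap)).choose

omit [IsMulCommutative ↥T₁] [IsMulCommutative ↥T₂] [CharZero k] [Fintype ι] in
/-- `θ♯ H = θ H` on `Lie(T₁)`. [folklore] -/
lemma thetaExt_apply (H : ↥(lieAlgebraGL T₁)) :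
    thetaExt hT₁ hT₂ (eX₁ := eX₁) (eX₂ := eX₂) (H : Matrix n₁ n₁ k) =
      ((theta eX₁ eX₂ hT₁.2.1 hT₂.2.1 H : ↥(lieAlgebraGL T₂)) : Matrix n₂ n₂ k) := by
  have h := (LinearMap.exists_extend ((lieAlgebraGL T₂).subtype.comp
    (theta eX₁ eX₂ hT₁.2.1 hT₂.2.1).toLinearMap)).choose_spec
  exact LinearMap.congr_fun h H

/-- A list of all root indices. [folklore] -/
def allRoots : List ι := (Finset.univ : Finset ι).toList

omit [IsMulCommutative ↥T₁] [IsMulCommutative ↥T₂] [IsAlgClosed k] [CharZero k] in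
/-- Every index lies in `allRoots`. [folklore] -/
lemma mem_allRoots (γ : ι) : γ ∈ (allRoots : List ι) := by simp [allRoots]

/-- The linear form `A ↦ tr (θ♯ (π A) φ)` on `𝔤𝔩_{n₁}`. [folklore] -/
def torusTraceForm (φ : Matrix n₂ n₂ k) : Matrix n₁ n₁ k →ₗ[k] k :=
  ((Matrix.traceLinearMap n₂ k k).comp (LinearMap.mulRight k φ)).comp
    ((thetaExt hT₁ hT₂ (eX₁ := eX₁) (eX₂ := eX₂)).comp (piOp h₁ allRoots))

omit [IsMulCommutative ↥T₂] [CharZero k] in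
/-- Unfolding of `torusTraceForm`. [folklore] -/
lemma torusTraceForm_apply (φ : Matrix n₂ n₂ k) (A : Matrix n₁ n₁ k) :
    torusTraceForm hT₁ hT₂ h₁ (eX₂ := eX₂) φ A =
      Matrix.trace (thetaExt hT₁ hT₂ (eX₁ := eX₁) (eX₂ := eX₂) (piOp h₁ allRoots A) * φ) := rfl

/-- **The trace functional `Ψ_φ (A, B) = tr (B φ) - tr (θ♯ (π A) φ)`** on `𝕃`. [folklore] -/
def traceFunctional (φ : Matrix n₂ n₂ k) : (Matrix n₁ n₁ k × Matrix n₂ n₂ k) →ₗ[k] k :=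
  ((Matrix.traceLinearMap n₂ k k).comp (LinearMap.mulRight k φ)).comp (LinearMap.snd k _ _) -
    (torusTraceForm hT₁ hT₂ h₁ (eX₂ := eX₂) φ).comp (LinearMap.fst k _ _)

omit [IsMulCommutative ↥T₂] [CharZero k] in
/-- Unfolding of `traceFunctional`. [folklore] -/
lemma traceFunctional_apply (φ : Matrix n₂ n₂ k) (A : Matrix n₁ n₁ k × Matrix n₂ n₂ k) :
    traceFunctional hT₁ hT₂ h₁ (eX₂ := eX₂) φ A =
      Matrix.trace (A.2 * φ) - Matrix.trace (thetaExt hT₁ hT₂ (eX₁ := eX₁) (eX₂ := eX₂) (piOp h₁ allRoots A.1) * φ) :=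
  rfl

variable {hG₁ hT₁ hG₂ hT₂ h₁ h₂}
variable {φ : Matrix n₂ n₂ k} (hφ : ∀ g ∈ G₂, ((g : GL n₂ k) : Matrix n₂ n₂ k) * φ = φ * g)

omit [CharZero k] [Fintype ι] in
include hφ h₂ in
/-- `tr (h²_γ φ) = 0` (`h²_γ = [e²_γ, f²_γ]` and `f²_γ ∈ 𝔤₂` commutes with `φ`). [folklore] -/
lemma trace_rootH_mul_eq_zero (γ : ι) : Matrix.trace (h₂.rootH γ * φ) = 0 := by
  haveI : Infinite k := IsAlgClosed.instInfinite
  rw [← h₂.lie_rootE_rootF γ]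
  exact trace_commutator_mul_eq_zero (commute_of_mem_lieAlgebraGL_of_forall hφ (h₂.rootF_mem γ).1)

omit [Fintype ι] in
include hφ h₂ in
/-- `tr (e²_γ φ) = 0` and `tr (f²_γ φ) = 0` (`e = ½ [h, e]`). [folklore] -/
lemma trace_rootE_mul_eq_zero (γ : ι) :
    Matrix.trace (h₂.rootE γ * φ) = 0 ∧ Matrix.trace (h₂.rootF γ * φ) = 0 := by
  haveI : Infinite k := IsAlgClosed.instInfinite
  constructor
  · have he : h₂.rootE γ = (2 : k)⁻¹ • (h₂.rootH γ * h₂.rootE γ - h₂.rootE γ * h₂.rootH γ) := by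
      rw [h₂.lie_rootH_rootE, smul_smul, inv_mul_cancel₀ two_ne_zero, one_smul]
    rw [he, Matrix.smul_mul, Matrix.trace_smul,
      trace_commutator_mul_eq_zero (commute_of_mem_lieAlgebraGL_of_forall hφ (h₂.rootE_mem γ).1), smul_zero]
  · have hf : h₂.rootF γ = -(2 : k)⁻¹ • (h₂.rootH γ * h₂.rootF γ - h₂.rootF γ * h₂.rootH γ) := by
      rw [h₂.lie_rootH_rootF, smul_neg, neg_smul, neg_neg, smul_smul, inv_mul_cancel₀ two_ne_zero, one_smul]
    rw [hf, Matrix.smul_mul, Matrix.trace_smul,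
      trace_commutator_mul_eq_zero (commute_of_mem_lieAlgebraGL_of_forall hφ (h₂.rootF_mem γ).1), smul_zero]

include hφ hG₁ hT₁ hT₂ h₂ in
/-- **The form `A, A' ↦ tr (θ♯ (π [A, A']) φ)` vanishes on pairs of weight components of `𝔤₁`.**
[cite: Humphreys1972, 14.2] -/
theorem torusTraceForm_lie_pieces
    {x x' : Option ι} {A A' : Matrix n₁ n₁ k}
    (hA : A ∈ (x.elim (lieAlgebraGL T₁) fun γ => lieWeightSpace G₁ T₁ (charOfWeight eX₁ (P.root γ))))
    (hA' : A' ∈ (x'.elim (lieAlgebraGL T₁) fun γ => lieWeightSpace G₁ T₁ (charOfWeight eX₁ (P.root γ)))) :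
    torusTraceForm hT₁ hT₂ h₁ (eX₂ := eX₂) φ (A * A' - A' * A) = 0 := by
  haveI : Infinite k := IsAlgClosed.instInfinite
  rw [torusTraceForm_apply]
  cases x with
  | none =>
    cases x' with
    | none =>
      -- torus, torus: the bracket vanishes
      simp only [Option.elim] at hA hA'
      rw [lie_eq_zero_of_mem_lieAlgebraGL_torus hA hA', map_zero, map_zero, Matrix.zero_mul, Matrix.trace_zero]
    | some δ =>
      -- torus, root: the bracket is in `𝔤_δ`, killed by `π`
      simp only [Option.elim] at hA hA'
      have hA0 : A ∈ lieWeightSpace G₁ T₁ (charOfWeight eX₁ 0) := by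
        rw [lieWeightSpace_charOfWeight_zero_eq]; exact lieAlgebraGL_le_lieWeightSpace_one hT₁.1 hA
      have hmem := lie_mem_lieWeightSpace_charOfWeight eX₁ hA0 hA'
      rw [zero_add] at hmem
      rw [piOp_apply_of_mem_root h₁ _ (mem_allRoots δ) hmem.2, map_zero, Matrix.zero_mul, Matrix.trace_zero]
  | some γ =>
    cases x' with
    | none =>
      simp only [Option.elim] at hA hA'
      have hA0 : A' ∈ lieWeightSpace G₁ T₁ (charOfWeight eX₁ 0) := by
        rw [lieWeightSpace_charOfWeight_zero_eq]; exact lieAlgebraGL_le_lieWeightSpace_one hT₁.1 hA'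
      have hmem := lie_mem_lieWeightSpace_charOfWeight eX₁ hA hA0
      rw [add_zero] at hmem
      rw [piOp_apply_of_mem_root h₁ _ (mem_allRoots γ) hmem.2, map_zero, Matrix.zero_mul, Matrix.trace_zero]
    | some δ =>
      simp only [Option.elim] at hA hA'
      have hmem := lie_mem_lieWeightSpace_charOfWeight eX₁ hA hA'
      by_cases hsum : P.root γ + P.root δ ∈ range P.root
      · obtain ⟨γ', hγ'⟩ := hsum
        rw [← hγ'] at hmem
        rw [piOp_apply_of_mem_root h₁ _ (mem_allRoots γ') hmem.2, map_zero, Matrix.zero_mul, Matrix.trace_zero]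
      · by_cases h0 : P.root γ + P.root δ = 0
        · -- `δ = -γ`: the bracket is a multiple of `h¹_γ`
          have hδ : P.root δ = -P.root γ := (neg_eq_of_add_eq_zero_right h0).symm
          have hA'' : A' ∈ lieWeightSpace G₁ T₁ (charOfWeight eX₁ (-P.root γ)) := by rw [← hδ]; exact hA'
          obtain ⟨c, hc⟩ := h₁.lie_eq_smul_rootH_of_mem hG₁ hT₁ γ hA hA''
          rw [hc, map_smul, piOp_apply_of_mem_torus h₁ _ (h₁.rootH_mem_lieAlgebraGL γ), map_smul,
            thetaExt_apply hT₁ hT₂ ⟨h₁.rootH γ, h₁.rootH_mem_lieAlgebraGL γ⟩, theta_rootH h₁ h₂,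
            Matrix.smul_mul, Matrix.trace_smul, trace_rootH_mul_eq_zero hφ γ,
            smul_zero]
        · rw [h₁.lieWeightSpace_charOfWeight_eq_bot hG₁ hT₁ h0 hsum, Submodule.mem_bot] at hmem
          rw [hmem, map_zero, map_zero, Matrix.zero_mul, Matrix.trace_zero]

omit [IsMulCommutative ↥T₁] [IsMulCommutative ↥T₂] [IsAlgClosed k] [CharZero k] [Fintype ι] in
/-- A bilinear form vanishing on all pairs from a family of subspaces vanishes on their supremum.
[folklore] -/
theorem bilin_eq_zero_of_forall_pieces {M : Type*} [AddCommGroup M] [Module k M] {κ : Type*}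
    (N : κ → Submodule k M) (β : M →ₗ[k] M →ₗ[k] k)
    (hβ : ∀ a b, ∀ u ∈ N a, ∀ v ∈ N b, β u v = 0) {u v : M} (hu : u ∈ ⨆ a, N a) (hv : v ∈ ⨆ a, N a) :
    β u v = 0 := by
  -- first in `u` for `v` in a piece, then in `v`
  have step : ∀ b, ∀ v ∈ N b, ∀ u ∈ ⨆ a, N a, β u v = 0 := by
    intro b v hv u hu
    have hle : (⨆ a, N a) ≤ LinearMap.ker (β.flip v) :=
      iSup_le fun a => fun u hu => by rw [LinearMap.mem_ker, LinearMap.flip_apply]; exact hβ a b u hu v hv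
    have := hle hu
    rwa [LinearMap.mem_ker, LinearMap.flip_apply] at this
  have hle : (⨆ a, N a) ≤ LinearMap.ker (β u) :=
    iSup_le fun b => fun v hv => by rw [LinearMap.mem_ker]; exact step b v hv u hu
  have := hle hv
  rwa [LinearMap.mem_ker] at this

include hφ hG₁ hT₁ hT₂ h₂ in
/-- **`tr (θ♯ (π [A, A']) φ) = 0` for all `A, A' ∈ 𝔤₁`.** [cite: Humphreys1972, 14.2] -/
theorem torusTraceForm_lie_eq_zero {A A' : Matrix n₁ n₁ k} (hA : A ∈ lieAlgebraGL G₁) (hA' : A' ∈ lieAlgebraGL G₁) :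
    torusTraceForm hT₁ hT₂ h₁ (eX₂ := eX₂) φ (A * A' - A' * A) = 0 := by
  let N : Option ι → Submodule k (Matrix n₁ n₁ k) := fun x =>
    x.elim (lieAlgebraGL T₁) fun γ => lieWeightSpace G₁ T₁ (charOfWeight eX₁ (P.root γ))
  let β : Matrix n₁ n₁ k →ₗ[k] Matrix n₁ n₁ k →ₗ[k] k :=
    (LinearMap.mul k (Matrix n₁ n₁ k) - (LinearMap.mul k (Matrix n₁ n₁ k)).flip).compr₂
      (torusTraceForm hT₁ hT₂ h₁ (eX₂ := eX₂) φ)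
  have hβ : ∀ u v, β u v = torusTraceForm hT₁ hT₂ h₁ (eX₂ := eX₂) φ (u * v - v * u) := fun u v => rfl
  have hle : lieAlgebraGL G₁ ≤ ⨆ x, N x := by
    refine (lieAlgebraGL_le_torus_sup_roots h₁ hG₁ hT₁ (eX₁ := eX₁)).trans (sup_le ?_ (iSup_le fun γ => ?_))
    · exact le_iSup N none
    · exact le_iSup N (some γ)
  rw [← hβ]
  refine bilin_eq_zero_of_forall_pieces N β (fun a b u hu v hv => ?_) (hle hA) (hle hA')
  have hu' : u ∈ a.elim (lieAlgebraGL T₁) fun γ => lieWeightSpace G₁ T₁ (charOfWeight eX₁ (P.root γ)) := hu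
  have hv' : v ∈ b.elim (lieAlgebraGL T₁) fun γ => lieWeightSpace G₁ T₁ (charOfWeight eX₁ (P.root γ)) := hv
  rw [hβ]
  exact torusTraceForm_lie_pieces (hG₁ := hG₁) (hT₁ := hT₁) (hT₂ := hT₂) (h₂ := h₂) hφ hu' hv'

include hφ hG₁ hT₁ hT₂ h₂ in
/-- **`Ψ_φ` kills the brackets of `𝔤₁ × 𝔤₂`.** [cite: Humphreys1972, 14.2] -/
theorem traceFunctional_lie_eq_zero {A B : Matrix n₁ n₁ k × Matrix n₂ n₂ k}
    (hA : A ∈ prodSubalgebra G₁ G₂) (hB : B ∈ prodSubalgebra G₁ G₂) :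
    traceFunctional hT₁ hT₂ h₁ (eX₂ := eX₂) φ ⁅A, B⁆ = 0 := by
  rw [mem_prodSubalgebra_iff] at hA hB
  rw [bracket_eq, traceFunctional_apply]
  change Matrix.trace ((A.2 * B.2 - B.2 * A.2) * φ) - torusTraceForm hT₁ hT₂ h₁ (eX₂ := eX₂) φ (A.1 * B.1 - B.1 * A.1) = 0
  rw [trace_commutator_mul_eq_zero (commute_of_mem_lieAlgebraGL_of_forall hφ hB.2),
    torusTraceForm_lie_eq_zero (hG₁ := hG₁) (hT₁ := hT₁) (hT₂ := hT₂) (h₂ := h₂) hφ hA.1 hB.1,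
    sub_self]

include hφ hT₂ h₂ in
/-- **`Ψ_φ` kills the generators of `D`.** [cite: Humphreys1972, 14.2] -/
theorem traceFunctional_eq_zero_of_mem_genSet {y : Y} {s : Matrix n₁ n₁ k × Matrix n₂ n₂ k}
    (hs : s ∈ genSet hT₁ hT₂ h₁ h₂ y) : traceFunctional hT₁ hT₂ h₁ (eX₂ := eX₂) φ s = 0 := by
  haveI : Infinite k := IsAlgClosed.instInfinite
  rw [traceFunctional_apply]
  rcases hs with ((⟨i, -, rfl⟩ | ⟨i, -, rfl⟩) | ⟨H, rfl⟩)
  · change Matrix.trace (h₂.rootE i * φ) - Matrix.trace (thetaExt hT₁ hT₂ (eX₁ := eX₁) (eX₂ := eX₂)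
      (piOp h₁ allRoots (h₁.rootE i)) * φ) = 0
    rw [(trace_rootE_mul_eq_zero (h₂ := h₂) hφ i).1,
      piOp_apply_of_mem_root h₁ _ (mem_allRoots i) (h₁.rootE_mem i).2, map_zero, Matrix.zero_mul,
      Matrix.trace_zero, sub_self]
  · change Matrix.trace (h₂.rootF i * φ) - Matrix.trace (thetaExt hT₁ hT₂ (eX₁ := eX₁) (eX₂ := eX₂)
      (piOp h₁ allRoots (h₁.rootF i)) * φ) = 0
    have hneg : -P.root i = P.root (P.reflectionPerm i i) := by
      rw [RootPairing.root_reflectionPerm, RootPairing.reflection_apply_self]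
    have hF : h₁.rootF i ∈ weightSpaceGL T₁ (charOfWeight eX₁ (P.root (P.reflectionPerm i i))) := by
      rw [← hneg]; exact (h₁.rootF_mem' i).2
    rw [(trace_rootE_mul_eq_zero (h₂ := h₂) hφ i).2,
      piOp_apply_of_mem_root h₁ _ (mem_allRoots _) hF, map_zero, Matrix.zero_mul, Matrix.trace_zero, sub_self]
  · change Matrix.trace (((theta eX₁ eX₂ hT₁.2.1 hT₂.2.1 H : ↥(lieAlgebraGL T₂)) : Matrix n₂ n₂ k) * φ) -
      Matrix.trace (thetaExt hT₁ hT₂ (eX₁ := eX₁) (eX₂ := eX₂) (piOp h₁ allRoots (H : Matrix n₁ n₁ k)) * φ) = 0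
    rw [piOp_apply_of_mem_torus h₁ _ H.2, thetaExt_apply, sub_self]

include hφ hG₁ hT₁ hT₂ in
/-- **`Ψ_φ` vanishes on the graph subalgebra `D`.** [cite: Humphreys1972, 14.2] -/
theorem traceFunctional_eq_zero_of_mem {y : Y} {A : Matrix n₁ n₁ k × Matrix n₂ n₂ k}
    (hA : A ∈ graphSubalgebra hT₁ hT₂ h₁ h₂ y) : traceFunctional hT₁ hT₂ h₁ (eX₂ := eX₂) φ A = 0 := by
  -- the subalgebra `{d ∈ 𝔤₁ × 𝔤₂ | Ψ d = 0}` contains the generators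
  let K : LieSubalgebra k (Matrix n₁ n₁ k × Matrix n₂ n₂ k) :=
    { __ := (prodSubalgebra G₁ G₂).toSubmodule ⊓ LinearMap.ker (traceFunctional hT₁ hT₂ h₁ (eX₂ := eX₂) φ)
      lie_mem' := by
        intro a b ha hb
        rw [Submodule.mem_carrier, SetLike.mem_coe, Submodule.mem_inf, LinearMap.mem_ker] at ha hb
        change ⁅a, b⁆ ∈ (prodSubalgebra G₁ G₂).toSubmodule ⊓ LinearMap.ker _
        rw [Submodule.mem_inf, LinearMap.mem_ker]
        exact ⟨(prodSubalgebra G₁ G₂).lie_mem ha.1 hb.1,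
          traceFunctional_lie_eq_zero (hG₁ := hG₁) (hT₁ := hT₁) (hT₂ := hT₂) (h₂ := h₂) hφ ha.1 hb.1⟩ }
  have hle : graphSubalgebra hT₁ hT₂ h₁ h₂ y ≤ K := by
    rw [graphSubalgebra, LieSubalgebra.lieSpan_le]
    intro s hs
    change s ∈ (prodSubalgebra G₁ G₂).toSubmodule ⊓ LinearMap.ker _
    rw [Submodule.mem_inf, LinearMap.mem_ker]
    exact ⟨graphSubalgebra_le_prod y (LieSubalgebra.subset_lieSpan hs),
      traceFunctional_eq_zero_of_mem_genSet (hT₂ := hT₂) (h₂ := h₂) hφ hs⟩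
  have h := hle hA
  change A ∈ (prodSubalgebra G₁ G₂).toSubmodule ⊓ LinearMap.ker _ at h
  rw [Submodule.mem_inf, LinearMap.mem_ker] at h
  exact h.2

include hG₁ hT₁ hT₂ in
/-- **`tr (B φ) = 0` whenever `(0, B) ∈ D` and `φ` commutes with `G₂`.** [cite: Humphreys1972, 14.2] -/
theorem trace_mul_eq_zero_of_inr_mem {y : Y} {B : Matrix n₂ n₂ k}
    (hB : (((0 : Matrix n₁ n₁ k), B) : Matrix n₁ n₁ k × Matrix n₂ n₂ k) ∈ graphSubalgebra hT₁ hT₂ h₁ h₂ y)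
    {φ : Matrix n₂ n₂ k} (hφ : ∀ g ∈ G₂, ((g : GL n₂ k) : Matrix n₂ n₂ k) * φ = φ * g) :
    Matrix.trace (B * φ) = 0 := by
  have h := traceFunctional_eq_zero_of_mem (hG₁ := hG₁) (hT₁ := hT₁) (hT₂ := hT₂)
    (h₁ := h₁) (h₂ := h₂) hφ hB
  rw [traceFunctional_apply] at h
  simpa [piOp_apply_of_mem_torus, map_zero] using h

end Functional

end LieGraph

end Literature.NumberTheory.Automorphic
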